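import Summits.RiemannHypothesis.RiemannHypothesis.Theorems.WeilFormatCDeflatedFarEnvelope
import Summits.RiemannHypothesis.RiemannHypothesis.Theorems.WeilFormatCDeflatedFarEntryLimits
import HarnessLib

/-!
# Format C, design C∞ ("DoorB"): the limit certificate with the free map folded INTO the coupling

Route context: Fourier–Galerkin / Schur-complement certificates of Weil positivity on a window ("format C";
cell memo `run/shared/lean/pub/rh-explicit/rh-explicit-weil-10/KERNEL-LEVER.md` §19–§20, sizing note
`run/shared/lean/pub/rh-explicit/rh-explicit-weil-2/gen9/CINF-DOOR-SIZING.md` §7; supporting stmt-RiemannHypothesis-0098;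
seat rh-explicit-weil-10).

`sum_range_mul_mul_nonneg_of_certificate_cinf` (`WeilFormatCDeflatedFarEnvelope`) asks the data side for a majorant `Uq` of the
limit coupling `Σ_m g_m²/d̂_m` AND for the `d̂`-weighted correction entries `A∞`, `ρ∞`, `σ∞` (series without closed form),
which enter its kernel inequality through `2Λᵀη∞ − ΛᵀA∞Λ`.  Completing the square with the free map inside the images,
`−Σ g²/d̂ + 2Λᵀη − ΛᵀAΛ = −Σ_m (g_m − (VΛ)_m)²/d̂_m`, gives the SAME certificate with ONE quadratic tail object and no
correction series (weil-2 gen9, "DoorB"): the data supplies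

* `Uq` with `Σ_{m∈[B,N)} (Σ_i M(i,m)x_i + Σ_j c∞(m,j)β_j − Σ_j V(m,j)Λ_j(x,β))²/d̂_m ≤ Uq(x,β)` for every `N`
  (`g − VΛ` lives in the same `m`-families as `g`: `WeilFormatCDeflatedFarCouplingGram` applies verbatim), and
* ONE kernel inequality `δ(Σx² + Σβ²) ≤ aug(x,β) − Uq(x,β) + 2Σ_j Λ_j(x,β)(β_j − Σ_{j'} E∞(j,j')β_{j'})`.

* `sum_image_sq_div_eq` — the finite identity `Σ_{[B,N)} g²/d̂ = Σ_{[B,N)} (g − VΛ)²/d̂ + T_N(Λ)` with the cross term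
  `T_N = 2Σ_j Λ_j(Σ_i ρ_N(j,i)x_i + Σ_{j''} σ_N(j,j'')β_{j''}) − Σ_{j,j'} Λ_jΛ_{j'}A_N(j,j')` over the PARTIAL entries;
* **`sum_range_mul_mul_nonneg_of_certificate_cinfB`** — the DoorB certificate: derived from the `…_cinf` theorem by
  instantiating `A∞, ρ∞, σ∞` with the series of `WeilFormatCDeflatedFarEntryLimits` inside the proof and bounding every
  partial coupling by the `N' → ∞` limit of `Uq + T_{N'}`.

Pure real analysis; standard axioms; nothing Weil-specific; no RH claim.
-/

-- `Summit.RiemannHypothesis.RiemannHypothesis.…` is the layout-mandated namespace (summit = problem name).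
set_option linter.dupNamespace false

namespace Summit.RiemannHypothesis.RiemannHypothesis.Theorems.WeilFormatC

open Finset Filter Topology

/-! ## The finite completion-of-the-square identity -/

/-- **Cross term of one mode, expanded**: with `v = Σ_j V_j l_j`, `g = Σ_i M_i x_i + Σ_{j''} c_{j''} β_{j''}`,
`(2vg − v²)/d = 2Σ_j l_j(Σ_i (V_jM_i/d)x_i + Σ_{j''} (V_jc_{j''}/d)β_{j''}) − Σ_{j,j'} l_jl_{j'}(V_jV_{j'}/d)`. -/
theorem cross_mode_expand {B r : ℕ} (Mi : Fin B → ℝ) (Vj cj : Fin r → ℝ) (d : ℝ) (x : Fin B → ℝ) (β l : Fin r → ℝ) :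
    (2 * (∑ j, Vj j * l j) * (∑ i, Mi i * x i + ∑ j'', cj j'' * β j'') - (∑ j, Vj j * l j) ^ 2) / d
      = 2 * ∑ j, l j * (∑ i, (Vj j * Mi i / d) * x i + ∑ j'', (Vj j * cj j'' / d) * β j'')
        - ∑ j, ∑ j', l j * l j' * (Vj j * Vj j' / d) := by
  have h1 : (∑ j, Vj j * l j) * (∑ i, Mi i * x i + ∑ j'', cj j'' * β j'') / d
      = ∑ j, l j * (∑ i, (Vj j * Mi i / d) * x i + ∑ j'', (Vj j * cj j'' / d) * β j'') := by
    rw [Finset.sum_mul, Finset.sum_div]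
    refine Finset.sum_congr rfl fun j _ ↦ ?_
    rw [mul_add, add_div, Finset.mul_sum, Finset.mul_sum, Finset.sum_div, Finset.sum_div, mul_add,
      Finset.mul_sum, Finset.mul_sum]
    congr 1
    · exact Finset.sum_congr rfl fun i _ ↦ by ring
    · exact Finset.sum_congr rfl fun j'' _ ↦ by ring
  have h2 : (∑ j, Vj j * l j) ^ 2 / d = ∑ j, ∑ j', l j * l j' * (Vj j * Vj j' / d) := by
    rw [sq, Finset.sum_mul_sum, Finset.sum_div]
    refine Finset.sum_congr rfl fun j _ ↦ ?_
    rw [Finset.sum_div]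
    exact Finset.sum_congr rfl fun j' _ ↦ by ring
  rw [sub_div, ← h2, show 2 * (∑ j, Vj j * l j) * (∑ i, Mi i * x i + ∑ j'', cj j'' * β j'') / d
      = 2 * ((∑ j, Vj j * l j) * (∑ i, Mi i * x i + ∑ j'', cj j'' * β j'') / d) by ring, h1]

/-- **Completion of the square, summed over a range**: for every finite set `s` of modes,
`Σ_{m∈s} g_m²/d̂_m = Σ_{m∈s} (g_m − v_m)²/d̂_m + [2Σ_j l_j(Σ_i ρ_s(j,i)x_i + Σ_{j''} σ_s(j,j'')β_{j''}) − Σ_{j,j'} l_jl_{j'}A_s(j,j')]`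
with `g_m = Σ_i M(i,m)x_i + Σ_{j''} c(m,j'')β_{j''}`, `v_m = Σ_j V(m,j)l_j` and the partial entries
`ρ_s(j,i) = Σ_{m∈s} V(m,j)M(i,m)/d̂_m`, `σ_s(j,j'') = Σ_{m∈s} V(m,j)c(m,j'')/d̂_m`, `A_s(j,j') = Σ_{m∈s} V(m,j)V(m,j')/d̂_m`. -/
theorem sum_image_sq_div_eq (M : ℕ → ℕ → ℝ) {B r : ℕ} (V c : ℕ → Fin r → ℝ) (dhat : ℕ → ℝ) (s : Finset ℕ)
    (x : Fin B → ℝ) (β l : Fin r → ℝ) :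
    ∑ m ∈ s, (∑ i : Fin B, M i m * x i + ∑ j, c m j * β j) ^ 2 / dhat m
      = ∑ m ∈ s, (∑ i : Fin B, M i m * x i + ∑ j, c m j * β j - ∑ j, V m j * l j) ^ 2 / dhat m
        + ((2 * ∑ j, l j * ((∑ i : Fin B, (∑ m ∈ s, V m j * M i m / dhat m) * x i)
              + ∑ j'', (∑ m ∈ s, V m j * c m j'' / dhat m) * β j''))
            - ∑ j, ∑ j', l j * l j' * ∑ m ∈ s, V m j * V m j' / dhat m) := by
  -- termwise split
  have hsplit : ∀ m, (∑ i : Fin B, M i m * x i + ∑ j, c m j * β j) ^ 2 / dhat m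
      = (∑ i : Fin B, M i m * x i + ∑ j, c m j * β j - ∑ j, V m j * l j) ^ 2 / dhat m
        + (2 * (∑ j, V m j * l j) * (∑ i : Fin B, M i m * x i + ∑ j, c m j * β j) - (∑ j, V m j * l j) ^ 2)
            / dhat m := fun m ↦ by ring
  rw [Finset.sum_congr rfl fun m _ ↦ hsplit m, Finset.sum_add_distrib]
  congr 1
  rw [Finset.sum_congr rfl fun m _ ↦ cross_mode_expand (fun i : Fin B ↦ M i m) (V m) (c m) (dhat m) x β l,
    Finset.sum_sub_distrib, ← Finset.mul_sum]
  congr 1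
  · congr 1
    rw [Finset.sum_comm]
    refine Finset.sum_congr rfl fun j _ ↦ ?_
    rw [← Finset.mul_sum, Finset.sum_add_distrib]
    congr 1
    congr 1
    · rw [Finset.sum_comm]
      refine Finset.sum_congr rfl fun i _ ↦ ?_
      rw [Finset.sum_mul]
    · rw [Finset.sum_comm]
      refine Finset.sum_congr rfl fun j'' _ ↦ ?_
      rw [Finset.sum_mul]
  · rw [Finset.sum_comm]
    refine Finset.sum_congr rfl fun j _ ↦ ?_
    rw [Finset.sum_comm]
    refine Finset.sum_congr rfl fun j' _ ↦ ?_
    rw [Finset.mul_sum]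

/-! ## The DoorB certificate -/

/-- **Soundness of the deflated format-C certificate with limit data, free map folded into the coupling ("DoorB").**
Same kernel/profile/limit hypotheses as `sum_range_mul_mul_nonneg_of_certificate_cinf` WITHOUT the correction entries
`A∞, ρ∞, σ∞`; the data are a far diagonal with floor and far inequality, a free map `Λ` with its `ℓ¹` bound, a majorant `Uq` of
`Σ_{m∈[B,N)} (g_m − Σ_j V(m,j)Λ_j)²/d̂_m` for EVERY `N` (`g_m = Σ_i M(i,m)x_i + Σ_j c∞(m,j)β_j`), and ONE kernel inequality
`δ(Σx² + Σβ²) ≤ aug − Uq + 2Σ_j Λ_j(β_j − Σ_{j'} E∞(j,j')β_{j'})`.  Conclusion: `0 ≤ Σ_{n,m<N} y_n y_m M(n,m)` for all `N`, `y`. -/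
theorem sum_range_mul_mul_nonneg_of_certificate_cinfB (M : ℕ → ℕ → ℝ) (hsymm : ∀ n m, M n m = M m n)
    {B : ℕ} (hB : 1 ≤ B) {r : ℕ} (V : ℕ → Fin r → ℝ) (dhat : ℕ → ℝ)
    {d₀ C₀ C₁ C₂ K : ℝ} (hd₀ : 0 < d₀) (hC₀ : 0 ≤ C₀) (hC₁ : 0 ≤ C₁) (hC₂ : 0 ≤ C₂) (hK : 0 ≤ K)
    (hd : ∀ m, B ≤ m → d₀ ≤ dhat m)
    (hfar : ∀ (N : ℕ) (y : ℕ → ℝ),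
      ∑ n ∈ Ico B N, dhat n * y n ^ 2 ≤ ∑ n ∈ Ico B N, ∑ m ∈ Ico B N, y n * M n m * y m)
    (hoff : ∀ n m, n ≠ m → |M n m| ≤ C₀ / |(n : ℝ) - m|)
    (hdiag : ∀ n, |M n n| ≤ C₁ + C₂ * Real.log (1 + n))
    (hV : ∀ n j, B ≤ n → |V n j| ≤ K / (n : ℝ) ^ 3)
    -- limit images and limit entries
    (cinf : ℕ → Fin r → ℝ)
    (hc : ∀ m j, Tendsto (fun P ↦ ∑ n ∈ Ico B P, M n m * V n j) atTop (𝓝 (cinf m j)))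
    (Ginf : Fin r → Fin r → ℝ)
    (hG : ∀ j j', Tendsto (fun P ↦ ∑ n ∈ Ico B P, ∑ m ∈ Ico B P, V n j * M n m * V m j') atTop (𝓝 (Ginf j j')))
    (Einf : Fin r → Fin r → ℝ)
    (hE : ∀ j j', Tendsto (fun P ↦ ∑ n ∈ Ico B P, V n j * V n j') atTop (𝓝 (Einf j j')))
    -- data
    (Λ : (Fin B → ℝ) → (Fin r → ℝ) → Fin r → ℝ) {lam : ℝ} (hlam : 0 ≤ lam)
    (hΛ : ∀ (x : Fin B → ℝ) (β : Fin r → ℝ), ∑ j, |Λ x β j| ≤ lam * (∑ i, |x i| + ∑ j, |β j|))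
    (Uq : (Fin B → ℝ) → (Fin r → ℝ) → ℝ)
    (hUq : ∀ (N : ℕ) (x : Fin B → ℝ) (β : Fin r → ℝ),
      ∑ m ∈ Ico B N, (∑ i : Fin B, M i m * x i + ∑ j, cinf m j * β j - ∑ j, V m j * Λ x β j) ^ 2 / dhat m ≤ Uq x β)
    {δ : ℝ} (hδ : 0 < δ)
    (hS : ∀ (x : Fin B → ℝ) (β : Fin r → ℝ),
      δ * (∑ i, x i ^ 2 + ∑ j, β j ^ 2) ≤
        ((∑ i : Fin B, ∑ i' : Fin B, x i * x i' * M i i')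
          + 2 * (∑ i : Fin B, ∑ j : Fin r, x i * β j * cinf i j)
          + (∑ j : Fin r, ∑ j' : Fin r, β j * β j' * Ginf j j'))
        - Uq x β
        + 2 * ∑ j, Λ x β j * (β j - ∑ j', Einf j j' * β j'))
    (N : ℕ) (y : ℕ → ℝ) :
    0 ≤ ∑ n ∈ range N, ∑ m ∈ range N, y n * y m * M n m := by
  -- the correction entries as series (never data)
  set Ainf : Fin r → Fin r → ℝ := fun j j' ↦ ∑' m, if B ≤ m then V m j * V m j' / dhat m else 0 with hAinf
  set ρinf : Fin r → Fin B → ℝ := fun j i ↦ ∑' m, if B ≤ m then V m j * M i m / dhat m else 0 with hρinf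
  set σinf : Fin r → Fin r → ℝ := fun j j'' ↦ ∑' m, if B ≤ m then V m j * cinf m j'' / dhat m else 0 with hσinf
  have hA : ∀ j j', Tendsto (fun P ↦ ∑ m ∈ Ico B P, V m j * V m j' / dhat m) atTop (𝓝 (Ainf j j')) :=
    fun j j' ↦ tendsto_weightedGram hB hd₀ hK hd hV j j'
  have hρ : ∀ (j : Fin r) (i : Fin B), Tendsto (fun P ↦ ∑ m ∈ Ico B P, V m j * M i m / dhat m) atTop (𝓝 (ρinf j i)) :=
    fun j i ↦ tendsto_weightedBlock hB hd₀ hC₀ hK hd hoff hV j i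
  have hσlim : ∀ j j'', Tendsto (fun P ↦ ∑ m ∈ Ico B P, V m j * cinf m j'' / dhat m) atTop (𝓝 (σinf j j'')) :=
    fun j j'' ↦ tendsto_weightedImage hB hd₀ hC₀ hC₁ hC₂ hK hd hoff hdiag hV (fun m j _ ↦ hc m j) j j''
  have hσ : ∀ j j'', Tendsto (fun P ↦ ∑ m ∈ Ico B P, V m j * (∑ n ∈ Ico B P, M n m * V n j'') / dhat m) atTop
      (𝓝 (σinf j j'')) :=
    fun j j'' ↦ tendsto_weightedImage_finite hB hd₀ hC₀ hC₁ hC₂ hK hd hoff hdiag hV (fun m j _ ↦ hc m j) j j''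
  -- the cross term and its limit
  set T : (Fin B → ℝ) → (Fin r → ℝ) → ℝ := fun x β ↦
    (2 * ∑ j, Λ x β j * ((∑ i, ρinf j i * x i) + ∑ j'', σinf j j'' * β j''))
      - ∑ j, ∑ j', Λ x β j * Λ x β j' * Ainf j j' with hT
  have hTlim : ∀ (x : Fin B → ℝ) (β : Fin r → ℝ), Tendsto (fun P ↦
      (2 * ∑ j, Λ x β j * ((∑ i : Fin B, (∑ m ∈ Ico B P, V m j * M i m / dhat m) * x i)
          + ∑ j'', (∑ m ∈ Ico B P, V m j * cinf m j'' / dhat m) * β j''))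
        - ∑ j, ∑ j', Λ x β j * Λ x β j' * ∑ m ∈ Ico B P, V m j * V m j' / dhat m) atTop (𝓝 (T x β)) := by
    intro x β
    refine Tendsto.sub (Tendsto.const_mul 2 (tendsto_finsetSum _ fun j _ ↦ Tendsto.const_mul _
      (Tendsto.add (tendsto_finsetSum _ fun i _ ↦ (hρ j i).mul_const _)
        (tendsto_finsetSum _ fun j'' _ ↦ (hσlim j j'').mul_const _))))
      (tendsto_finsetSum _ fun j _ ↦ tendsto_finsetSum _ fun j' _ ↦ (hA j j').const_mul _)
  -- the coupling majorant of the original door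
  have hUq' : ∀ (N : ℕ) (x : Fin B → ℝ) (β : Fin r → ℝ),
      ∑ m ∈ Ico B N, (∑ i : Fin B, M i m * x i + ∑ j, cinf m j * β j) ^ 2 / dhat m ≤ Uq x β + T x β := by
    intro N x β
    -- every later partial sum bounds this one, and equals the completed square plus the partial cross term
    have hmono : ∀ N', N ≤ N' → ∑ m ∈ Ico B N, (∑ i : Fin B, M i m * x i + ∑ j, cinf m j * β j) ^ 2 / dhat m
        ≤ Uq x β + ((2 * ∑ j, Λ x β j * ((∑ i : Fin B, (∑ m ∈ Ico B N', V m j * M i m / dhat m) * x i)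
            + ∑ j'', (∑ m ∈ Ico B N', V m j * cinf m j'' / dhat m) * β j''))
          - ∑ j, ∑ j', Λ x β j * Λ x β j' * ∑ m ∈ Ico B N', V m j * V m j' / dhat m) := by
      intro N' hNN'
      have hsub : Ico B N ⊆ Ico B N' := Finset.Ico_subset_Ico_right hNN'
      calc ∑ m ∈ Ico B N, (∑ i : Fin B, M i m * x i + ∑ j, cinf m j * β j) ^ 2 / dhat m
          ≤ ∑ m ∈ Ico B N', (∑ i : Fin B, M i m * x i + ∑ j, cinf m j * β j) ^ 2 / dhat m :=
            Finset.sum_le_sum_of_subset_of_nonneg hsub fun m hm _ ↦ by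
              have := lt_of_lt_of_le hd₀ (hd m (Finset.mem_Ico.1 hm).1); positivity
        _ = _ := sum_image_sq_div_eq M V cinf dhat (Ico B N') x β (Λ x β)
        _ ≤ _ := add_le_add (hUq N' x β) le_rfl
    have hev : ∀ᶠ N' in atTop, ∑ m ∈ Ico B N, (∑ i : Fin B, M i m * x i + ∑ j, cinf m j * β j) ^ 2 / dhat m
        ≤ Uq x β + ((2 * ∑ j, Λ x β j * ((∑ i : Fin B, (∑ m ∈ Ico B N', V m j * M i m / dhat m) * x i)
            + ∑ j'', (∑ m ∈ Ico B N', V m j * cinf m j'' / dhat m) * β j''))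
          - ∑ j, ∑ j', Λ x β j * Λ x β j' * ∑ m ∈ Ico B N', V m j * V m j' / dhat m) :=
      Filter.eventually_atTop.2 ⟨N, hmono⟩
    exact ge_of_tendsto ((hTlim x β).const_add (Uq x β)) hev
  -- apply the original door with `Uq' := Uq + T`
  refine sum_range_mul_mul_nonneg_of_certificate_cinf M hsymm hB V dhat hd₀ hC₀ hC₁ hC₂ hK hd hfar hoff hdiag hV
    cinf hc Ginf hG Einf Ainf σinf ρinf hE hA hρ hσ Λ hlam hΛ (fun x β ↦ Uq x β + T x β) hUq' hδ ?_ N y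
  intro x β
  have h := hS x β
  have e : 2 * ∑ j, Λ x β j * ((β j - ∑ j', Einf j j' * β j') + (∑ i, ρinf j i * x i + ∑ j'', σinf j j'' * β j''))
      = 2 * ∑ j, Λ x β j * (β j - ∑ j', Einf j j' * β j')
        + 2 * ∑ j, Λ x β j * ((∑ i, ρinf j i * x i) + ∑ j'', σinf j j'' * β j'') := by
    rw [← mul_add, ← Finset.sum_add_distrib]
    congr 1
    exact Finset.sum_congr rfl fun j _ ↦ by ring
  rw [e, hT]
  linarith

end Summit.RiemannHypothesis.RiemannHypothesis.Theorems.WeilFormatC
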